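import Summits.AtomisticToContinuum.BoseEinsteinCondensation.Theses.BECStronglyRayleigh
import Summits.AtomisticToContinuum.BoseEinsteinCondensation.Theorems.BECStronglyRayleighGroundStateStabilityConeSelection
import Summits.AtomisticToContinuum.BoseEinsteinCondensation.Theorems.BECStronglyRayleighGroundStateStabilityEulerGate
import Summits.AtomisticToContinuum.BoseEinsteinCondensation.Theorems.BECStronglyRayleighGroundStateStabilityEulerLimit
import Summits.AtomisticToContinuum.BoseEinsteinCondensation.Theorems.BECStronglyRayleighGroundStateStabilitySiteFactor
import Summits.AtomisticToContinuum.BoseEinsteinCondensation.Theorems.BECStronglyRayleighGroundStateStabilityTrotterClosure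
import Summits.AtomisticToContinuum.BoseEinsteinCondensation.Theorems.BECStronglyRayleighGroundStateStabilitySpectralMapping
import Summits.AtomisticToContinuum.BoseEinsteinCondensation.Theorems.BECStronglyRayleighGroundStateStabilitySectorPerron
import Summits.AtomisticToContinuum.BoseEinsteinCondensation.Theorems.BECStronglyRayleighGroundStateStabilityGibbsStructure
import Literature.Combinatorics.StablePolynomials.KernelForm
import Literature.Combinatorics.StablePolynomials.Limits
import Literature.Combinatorics.StablePolynomials.ElementarySymmetric
import Literature.MathematicalPhysics.QuantumLattice.PerronFrobeniusGroundState
import Literature.MathematicalPhysics.QuantumLattice.SectorSpectrum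
import Literature.MathematicalPhysics.QuantumLattice.LiebMattisLadder
import Literature.MathematicalPhysics.QuantumLattice.LiebMattisSectorPF
import Literature.MathematicalPhysics.QuantumLattice.TokenSliding
import Literature.MathematicalPhysics.QuantumLattice.LieTrotter
import Literature.MathematicalPhysics.QuantumLattice.TraceInequalitiesProofs
import Literature.MathematicalPhysics.QuantumLattice.XYOrderDischarges
import Literature.MathematicalPhysics.QuantumLattice.DuhamelTwoPoint
import HarnessLib

/-!
# `GroundStateStability` (crux of route BECStronglyRayleigh, item stmt-AtomisticToContinuum-9672):
# sector ground states of the hard-core XXZ model with fields are upper-half-plane stable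

**Theorem S.** For every finite connected graph `G` on `Λ`, every `|Δ| ≤ 1`, every real field
`μ : Λ → ℝ` and every magnetisation sector `M`, every sector ground vector `ψ` of
`H = xxzHamiltonian 1 G (-1) Δ + Σ_x μ_x S³_x` (hard-core bosons, hopping `-½` per edge,
nearest-neighbour interaction `-Δ S³S³`) has an occupation polynomial `Σ_S ψ(1_S) ∏_{x∈S} z_x` with no
zero in `H^Λ` (occupied = spin up = `Fin`-index `0`).

This file is the COMPOSITION of the line `stable-cone-variational-selection`
(`Cruxes/GroundStateStability/Lines/stable-cone-variational-selection.lean`), all of whose stubs are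
landed in `Theorems/BECStronglyRayleighGroundStateStability*.lean`:
* A `stub_eulerGate` — the Euler bond gate `1 + ε(S¹S¹+S²S²+ΔS³S³)`, `0 ≤ ε ≤ 1`, is a Borcea–Brändén
  preserver iff `|Δ| ≤ 1` (six-vertex triangle window; kernel form of BB Lemma 2.2);
* B1 `stub_eulerLimit` (Euler limit `(1 + tX/n)ⁿ → e^{tX}` + Hurwitz), B2 `stub_siteFactor` (diagonal
  field factor), C `stub_trotterClosure` (Lie product formula + Hurwitz): the transfer `C⁺` —
  `e^{-τH}` preserves stability for every `τ ≥ 0`;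
* D `stub_coneSelection` — the lever: a PSD operator mapping the closed cone of entrywise-nonnegative
  sector vectors with stable occupation polynomial into itself has an eigenvector in that cone;
* E1 `stub_gibbsStructure` (PSD, entrywise nonnegative, sector-preserving), E2 `stub_spectralMapping`
  (eigenvectors of `e^{-τH}` are eigenvectors of `H`);
* F `stub_sectorPerron` — Perron–Frobenius in a magnetisation sector (uniqueness of sector ground
  vectors; a nonnegative sector eigenvector is a ground vector).
Hence the stable cone eigenvector of `e^{-H}` is THE sector ground ray and `ψ` is a nonzero multiple
of it: `GroundStateStability_of`, concluded BY NAME (`GroundStateStability_proof` is the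
`Theorems`-namespace alias).
-/


namespace Summit.AtomisticToContinuum.BoseEinsteinCondensation.Cruxes.GroundStateStability.StableConeVariationalSelection

open scoped BigOperators Matrix ComplexOrder
open Literature.MathematicalPhysics.QuantumLattice

/-- **Theorem S (composition of the line `stable-cone-variational-selection`).** The landed stubs
A, B1, B2, C, D, E1, E2, F imply the crux `BECStronglyRayleigh.GroundStateStability`, concluded BY
NAME with no hypotheses: `C⁺` (Stubs A, B1,
B2, C) and the structure facts (E1) make `T = e^{-H}` a PSD self-map of the stable cone `K_M`; the
selection lemma (D) gives an eigenvector `φ ∈ K_M` of `T`; spectral mapping (E2) and sector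
Perron–Frobenius (F) identify `φ` with the sector ground ray, so the given ground vector
`ψ = c • φ`, `c ≠ 0`, has a stable occupation polynomial. -/
theorem GroundStateStability_of :
    Summit.AtomisticToContinuum.BoseEinsteinCondensation.Theses.BECStronglyRayleigh.GroundStateStability := by
  have hA := @stub_eulerGate
  have hB1 := @stub_eulerLimit
  have hB2 := @stub_siteFactor
  have hC := @stub_trotterClosure
  have hD := @stub_coneSelection
  have hE1 := @stub_gibbsStructure
  have hE2 := @stub_spectralMapping
  have hF := @stub_sectorPerron
  intro Λ _ _ G _ hG Δ μ hΔ M ψ hψ hψ0 hH z hz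
  -- C⁺ : the Gibbs semigroup preserves stability (Stubs A → B1, B2 → C)
  have hbond : ∀ (Λ : Type) [Fintype Λ] [DecidableEq Λ] (x y : Λ), x ≠ y → ∀ (Δ t : ℝ), |Δ| ≤ 1 →
      0 ≤ t → ∀ φ : TensorIndex Λ 2 → ℂ,
        (∀ z : Λ → ℂ, (∀ i, 0 < (z i).im) →
          (∑ S : Finset Λ, φ (fun i => if i ∈ S then 0 else 1) * ∏ i ∈ S, z i) ≠ 0) →
        (∀ z : Λ → ℂ, (∀ i, 0 < (z i).im) →
          (∑ S : Finset Λ, (NormedSpace.exp ((t : ℂ) • (spinBond 1 0 x y + spinBond 1 1 x y +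
            (Δ : ℂ) • spinBond 1 2 x y)) *ᵥ φ) (fun i => if i ∈ S then 0 else 1) *
              ∏ i ∈ S, z i) ≠ 0) :=
    fun Λ _ _ x y hxy Δ t hΔ ht φ hφ =>
      hB1 Λ _ (fun ε hε0 hε1 φ' hφ' => hA Λ x y hxy Δ ε hΔ hε0 hε1 φ' hφ') t ht φ hφ
  have hsemi := hC hbond hB2
  -- structure of T = e^{-H} (Stub E1 at τ = 1)
  obtain ⟨hpsd, hnn, hsec⟩ := hE1 Λ G Δ μ 1 one_pos
  -- the lever (Stub D): an eigenvector of T inside the stable cone of the sector of ψ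
  obtain ⟨φ, hφS, hφR, hφst, c, hc⟩ := hD Λ M
    (Matrix.gibbsWeight 1 (xxzHamiltonian 1 G (-1) Δ + ∑ x : Λ, ((μ x : ℝ) : ℂ) • siteSpin 1 x 2))
    hpsd ⟨ψ, hψ, hψ0⟩
    (fun φ hS hR hst => ⟨hsec M φ hS, hnn φ hR, hsemi Λ G Δ μ hΔ 1 zero_le_one φ hst⟩)
  -- a stable vector is nonzero
  have hφ0 : φ ≠ 0 := coneSel_ne_zero_of_stable hφst
  -- spectral mapping (Stub E2): φ is an eigenvector of H …
  obtain ⟨E, hEφ⟩ := hE2 (TensorIndex Λ 2) _ (leadPF_isHermitian G Δ μ) 1 one_ne_zero φ (c : ℂ)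
    hφ0 hc
  -- … and by sector Perron–Frobenius (Stub F) a ground vector of the sector, unique up to scalars
  obtain ⟨-, hground⟩ := hF Λ G hG Δ μ M ψ hψ hψ0 hH
  have hEeq := hground φ E hφS hφR hφ0 hEφ
  rw [hEeq] at hEφ
  obtain ⟨huniq, -⟩ := hF Λ G hG Δ μ M φ hφS hφ0 hEφ
  obtain ⟨c', hc'⟩ := huniq ψ hψ hH
  have hc'0 : c' ≠ 0 := by
    rintro rfl
    exact hψ0 (by rw [hc', zero_smul])
  -- conclude: the occupation polynomial of ψ = c' • φ is c' times that of φ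
  rw [hc', coneSel_occ_smul]
  exact mul_ne_zero hc'0 (hφst z hz)

end Summit.AtomisticToContinuum.BoseEinsteinCondensation.Cruxes.GroundStateStability.StableConeVariationalSelection

/-- **Theorem S** — `Theorems`-namespace alias of the composition
`StableConeVariationalSelection.GroundStateStability_of` closing item stmt-AtomisticToContinuum-9672.
[folklore] -/
theorem Summit.AtomisticToContinuum.BoseEinsteinCondensation.Theorems.GroundStateStability_proof :
    Summit.AtomisticToContinuum.BoseEinsteinCondensation.Theses.BECStronglyRayleigh.GroundStateStability :=
  Summit.AtomisticToContinuum.BoseEinsteinCondensation.Cruxes.GroundStateStability.StableConeVariationalSelection.GroundStateStability_of
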